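import Literature.NumberTheory.GaloisRepresentations.NearlyOrdinaryDeformationRingProofs
import HarnessLib

/-!
# Lifts of a representation to the dual numbers are `ad`-valued 1-cocycles
# (Mazur §21; Böckle Thm. 2.2 (a): `t = H¹(Π, ad ρ̄)`)

Topic `Literature/NumberTheory/GaloisRepresentations`.  Let `Γ` be a group, `K` a commutative
ring and `ρ̄ : Γ → GL_n(K)`.  A **lift of `ρ̄` to the dual numbers** is a homomorphism
`ρ : Γ → GL_n(K[ε])` reducing to `ρ̄` modulo `ε`; writing `ρ = (1 + ε c) ρ̄`, the function
`c : Γ → M_n(K)` is a **1-cocycle for the adjoint action** `ad ρ̄` (`c(gh) = c(g) + ρ̄(g) c(h) ρ̄(g)⁻¹`),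
and conversely; two lifts are strictly equivalent (conjugate by a matrix `≡ 1 mod ε`) iff their
cocycles differ by a coboundary `g ↦ X − ρ̄(g) X ρ̄(g)⁻¹`.  This is the dictionary behind
"`t_R ≅ H¹(Π, ad ρ̄)`" (Mazur, *Deforming Galois representations* (1989), §1.2 Prop. 1 and
[Maz97, §21]; Böckle [Böc07, Thm. 2.2 (a)]), here as pure matrix algebra — no topology, no
deformation conditions.  Everything is PROVED:

* `Deformation.DualLift ρ̄`, `Deformation.AdCocycle ρ̄` — the two sides;
* `Deformation.DualLift.cocycle`, `Deformation.AdCocycle.lift`, `Deformation.dualLiftEquiv` —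
  the bijection `ρ ↦ (g ↦ ε`-part of `ρ(g) · ρ̄(g)⁻¹)`, `c ↦ (1 + εc)ρ̄`;
* `Deformation.DualLift.exists_conj_iff`, `Deformation.DualLift.isStrictEquiv_iff` — strict
  equivalence (conjugation by `P ≡ 1 mod ε`) ⟺ the cocycles differ by a coboundary.

## References

* B. Mazur, *An introduction to the deformation theory of Galois representations* (1997), §21
  ("`t_ρ̄ ≅ H¹(Π, ad ρ̄)`"). [cite: Mazur1997Deformation, §21]
* G. Böckle, *Presentations of universal deformation rings*, LMS LNS 320 (2007), Thm. 2.2 (a).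
  [cite: Bockle2007Presentations, Theorem 2.2]
-/

noncomputable section

namespace Literature.NumberTheory.GaloisRepresentations.Deformation

open Matrix TrivSqZeroExt

variable {Γ : Type*} [Group Γ] {K : Type*} [CommRing K] {n : Type*} [Fintype n] [DecidableEq n]

/-! ## Matrices over `K[ε]` from their two components -/

/-- The matrix over `K[ε]` with `fst`-part `A` and `snd`-part `B` (`A + εB`). [folklore] -/
def dualMatrix (A B : Matrix n n K) : Matrix n n (TrivSqZeroExt K K) :=
  Matrix.of fun i j => inl (A i j) + inr (B i j)

omit [Fintype n] [DecidableEq n] in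
/-- `fst (A + εB) = A`. [folklore] -/
@[simp] theorem dualMatrix_map_fst (A B : Matrix n n K) : (dualMatrix A B).map fst = A := by
  ext i j
  simp [dualMatrix]

omit [Fintype n] [DecidableEq n] in
/-- `snd (A + εB) = B`. [folklore] -/
@[simp] theorem dualMatrix_map_snd (A B : Matrix n n K) : (dualMatrix A B).map snd = B := by
  ext i j
  simp [dualMatrix]

omit [Fintype n] [DecidableEq n] in
/-- Every matrix over `K[ε]` is `fst + ε snd`. [folklore] -/
theorem dualMatrix_map_fst_map_snd (N : Matrix n n (TrivSqZeroExt K K)) :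
    dualMatrix (N.map fst) (N.map snd) = N :=
  matrix_ext_fst_snd (dualMatrix_map_fst _ _) (dualMatrix_map_snd _ _)

omit [Fintype n] in
/-- `fst` of the identity matrix is the identity. [folklore] -/
theorem matrix_map_fst_one : (1 : Matrix n n (TrivSqZeroExt K K)).map fst = 1 := by
  ext i j
  rw [Matrix.map_apply, Matrix.one_apply, Matrix.one_apply]
  split_ifs
  · exact fst_one
  · exact fst_zero

/-- **A matrix over `K[ε]` with invertible `fst`-part is invertible**: for `u ∈ GL_n(K)` and any
`B`, `u + εB` is a unit with inverse `u⁻¹ − ε u⁻¹ B u⁻¹`. [folklore] -/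
def dualUnit (u : GL n K) (B : Matrix n n K) : GL n (TrivSqZeroExt K K) where
  val := dualMatrix u.val B
  inv := dualMatrix u⁻¹.val (-(u⁻¹.val * B * u⁻¹.val))
  val_inv := by
    refine matrix_ext_fst_snd ?_ ?_
    · rw [matrix_map_fst_mul, dualMatrix_map_fst, dualMatrix_map_fst, matrix_map_fst_one,
        ← Units.val_mul, mul_inv_cancel, Units.val_one]
    · rw [matrix_map_snd_mul, dualMatrix_map_fst, dualMatrix_map_snd, dualMatrix_map_fst,
        dualMatrix_map_snd, matrix_map_snd_one, Matrix.mul_neg, ← Matrix.mul_assoc,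
        ← Matrix.mul_assoc, ← Units.val_mul, mul_inv_cancel, Units.val_one, Matrix.one_mul,
        neg_add_cancel]
  inv_val := by
    refine matrix_ext_fst_snd ?_ ?_
    · rw [matrix_map_fst_mul, dualMatrix_map_fst, dualMatrix_map_fst, matrix_map_fst_one,
        ← Units.val_mul, inv_mul_cancel, Units.val_one]
    · rw [matrix_map_snd_mul, dualMatrix_map_fst, dualMatrix_map_snd, dualMatrix_map_fst,
        dualMatrix_map_snd, matrix_map_snd_one, Matrix.neg_mul, Matrix.mul_assoc,
        Matrix.mul_assoc, ← Units.val_mul, inv_mul_cancel, Units.val_one, Matrix.mul_one,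
        add_neg_cancel]

/-- `fst (dualUnit u B) = u`. [folklore] -/
@[simp] theorem dualUnit_val_map_fst (u : GL n K) (B : Matrix n n K) :
    (dualUnit u B).val.map fst = u.val :=
  dualMatrix_map_fst _ _

/-- `snd (dualUnit u B) = B`. [folklore] -/
@[simp] theorem dualUnit_val_map_snd (u : GL n K) (B : Matrix n n K) :
    (dualUnit u B).val.map snd = B :=
  dualMatrix_map_snd _ _

/-! ## Lifts to `K[ε]` and `ad`-cocycles -/

variable (ρbar : Γ →* GL n K)

/-- **Lifts of `ρ̄ : Γ → GL_n(K)` to the dual numbers**: homomorphisms `ρ : Γ → GL_n(K[ε])` with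
`ρ ≡ ρ̄ mod ε`. [cite: Mazur1997Deformation, §21] -/
abbrev DualLift : Type _ :=
  {ρ : Γ →* GL n (TrivSqZeroExt K K) // ∀ g, (ρ g).val.map fst = (ρbar g).val}

/-- **1-cocycles of `Γ` with values in `ad ρ̄ = M_n(K)`** (conjugation action):
`c(gh) = c(g) + ρ̄(g) c(h) ρ̄(g)⁻¹`. [cite: Mazur1997Deformation, §21] -/
abbrev AdCocycle : Type _ :=
  {c : Γ → Matrix n n K // ∀ g h, c (g * h) = c g + (ρbar g).val * c h * (ρbar g)⁻¹.val}

variable {ρbar}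

namespace DualLift

/-- The `ε`-part `S(g) = snd ρ(g)` of a lift. [folklore] -/
def sndPart (ρ : DualLift ρbar) (g : Γ) : Matrix n n K := (ρ.1 g).val.map snd

/-- Leibniz rule for the `ε`-parts of a lift: `S(gh) = ρ̄(g) S(h) + S(g) ρ̄(h)`. [folklore] -/
theorem sndPart_mul (ρ : DualLift ρbar) (g h : Γ) :
    ρ.sndPart (g * h) = (ρbar g).val * ρ.sndPart h + ρ.sndPart g * (ρbar h).val := by
  simp only [sndPart]
  rw [map_mul, Units.val_mul, matrix_map_snd_mul, ρ.2 g, ρ.2 h]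

/-- **The cocycle of a lift**: `c(g) = snd ρ(g) · ρ̄(g)⁻¹` (so that `ρ = (1 + εc)ρ̄`).
[cite: Mazur1997Deformation, §21] -/
def cocycle (ρ : DualLift ρbar) : AdCocycle ρbar :=
  ⟨fun g => ρ.sndPart g * (ρbar g)⁻¹.val, fun g h => by
    dsimp only
    rw [sndPart_mul, map_mul, _root_.mul_inv_rev, Units.val_mul]
    simp only [Matrix.add_mul, Matrix.mul_assoc, Units.mul_inv_cancel_left]
    rw [add_comm]⟩

/-- Unfolding lemma for `cocycle`. [folklore] -/
theorem cocycle_apply (ρ : DualLift ρbar) (g : Γ) :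
    (ρ.cocycle).1 g = (ρ.1 g).val.map snd * (ρbar g)⁻¹.val := rfl

end DualLift

namespace AdCocycle

/-- A cocycle vanishes at `1`. [folklore] -/
theorem apply_one (c : AdCocycle ρbar) : c.1 1 = 0 := by
  have h := c.2 1 1
  rw [mul_one, map_one, inv_one, Units.val_one, Matrix.one_mul, Matrix.mul_one] at h
  -- `c 1 = c 1 + c 1`
  have h2 : c.1 1 + c.1 1 = c.1 1 + 0 := by rw [add_zero]; exact h.symm
  exact add_left_cancel h2

/-- **The lift `(1 + εc)ρ̄` of a cocycle**, value at `g`: the unit `ρ̄(g) + ε c(g)ρ̄(g)`.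
[cite: Mazur1997Deformation, §21] -/
def liftAt (c : AdCocycle ρbar) (g : Γ) : GL n (TrivSqZeroExt K K) :=
  dualUnit (ρbar g) (c.1 g * (ρbar g).val)

/-- `fst` of `liftAt`. [folklore] -/
@[simp] theorem liftAt_val_map_fst (c : AdCocycle ρbar) (g : Γ) :
    (c.liftAt g).val.map fst = (ρbar g).val :=
  dualUnit_val_map_fst _ _

/-- `snd` of `liftAt`. [folklore] -/
@[simp] theorem liftAt_val_map_snd (c : AdCocycle ρbar) (g : Γ) :
    (c.liftAt g).val.map snd = c.1 g * (ρbar g).val :=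
  dualUnit_val_map_snd _ _

/-- **The lift `(1 + εc)ρ̄ : Γ → GL_n(K[ε])` of a cocycle** is a homomorphism.
[cite: Mazur1997Deformation, §21] -/
def lift (c : AdCocycle ρbar) : DualLift ρbar :=
  ⟨{ toFun := c.liftAt
     map_one' := by
       apply Units.ext
       refine matrix_ext_fst_snd ?_ ?_
       · rw [liftAt_val_map_fst, map_one, Units.val_one, Units.val_one, matrix_map_fst_one]
       · rw [liftAt_val_map_snd, apply_one, Matrix.zero_mul, Units.val_one, matrix_map_snd_one]
     map_mul' := fun g h => by
       apply Units.ext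
       refine matrix_ext_fst_snd ?_ ?_
       · rw [liftAt_val_map_fst, Units.val_mul, matrix_map_fst_mul, liftAt_val_map_fst,
           liftAt_val_map_fst, map_mul, Units.val_mul]
       · rw [liftAt_val_map_snd, Units.val_mul, matrix_map_snd_mul, liftAt_val_map_fst,
           liftAt_val_map_snd, liftAt_val_map_fst, liftAt_val_map_snd, c.2 g h, map_mul,
           Units.val_mul]
         simp only [Matrix.add_mul, Matrix.mul_assoc, Units.inv_mul_cancel_left]
         rw [add_comm] },
    fun g => liftAt_val_map_fst c g⟩

/-- Unfolding lemma for `lift`. [folklore] -/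
theorem lift_apply (c : AdCocycle ρbar) (g : Γ) : (c.lift).1 g = c.liftAt g := rfl

end AdCocycle

/-- **Lifts of `ρ̄` to `K[ε]` ≃ 1-cocycles with values in `ad ρ̄`** (`ρ ↦ snd ρ · ρ̄⁻¹`,
`c ↦ (1 + εc)ρ̄`): the dictionary behind `t_ρ̄ ≅ H¹(Π, ad ρ̄)`.
[cite: Mazur1997Deformation, §21] [cite: Bockle2007Presentations, Theorem 2.2] -/
def dualLiftEquiv : DualLift ρbar ≃ AdCocycle ρbar where
  toFun := DualLift.cocycle
  invFun := AdCocycle.lift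
  left_inv ρ := by
    refine Subtype.ext (MonoidHom.ext fun g => Units.ext ?_)
    rw [AdCocycle.lift_apply]
    refine matrix_ext_fst_snd ?_ ?_
    · rw [AdCocycle.liftAt_val_map_fst, ρ.2 g]
    · rw [AdCocycle.liftAt_val_map_snd, DualLift.cocycle_apply, Matrix.mul_assoc,
        ← Units.val_mul, inv_mul_cancel, Units.val_one, Matrix.mul_one]
  right_inv c := by
    refine Subtype.ext (funext fun g => ?_)
    rw [DualLift.cocycle_apply, AdCocycle.lift_apply, AdCocycle.liftAt_val_map_snd,
      Matrix.mul_assoc, ← Units.val_mul, mul_inv_cancel, Units.val_one, Matrix.mul_one]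

/-! ## Strict equivalence = coboundaries -/

namespace DualLift

/-- A matrix `P ∈ GL_n(K[ε])` with `P ≡ 1 mod ε` is `1 + εX` with `X = snd P`, and
conjugation by it changes the `ε`-part of `ρ(g) = (ρ̄(g), S(g))` to
`S(g) + X ρ̄(g) − ρ̄(g) X`. [folklore] -/
theorem map_snd_conj {P : GL n (TrivSqZeroExt K K)} (hP : P.val.map fst = 1)
    (ρ : DualLift ρbar) (g : Γ) :
    (P * ρ.1 g * P⁻¹).val.map snd =
      ρ.sndPart g + P.val.map snd * (ρbar g).val - (ρbar g).val * P.val.map snd := by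
  have hPinv_fst : P⁻¹.val.map fst = 1 := by
    have h := congrArg (fun M : Matrix n n (TrivSqZeroExt K K) => M.map fst) P.mul_inv
    simp only [matrix_map_fst_mul, hP, Matrix.one_mul, matrix_map_fst_one] at h
    exact h
  have hPinv_snd : P⁻¹.val.map snd = -P.val.map snd := by
    have h := congrArg (fun M : Matrix n n (TrivSqZeroExt K K) => M.map snd) P.mul_inv
    simp only [matrix_map_snd_mul, hP, hPinv_fst, Matrix.one_mul, Matrix.mul_one,
      matrix_map_snd_one] at h
    exact eq_neg_of_add_eq_zero_left h
  rw [Units.val_mul, Units.val_mul, matrix_map_snd_mul, matrix_map_fst_mul, matrix_map_snd_mul,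
    hP, ρ.2 g, hPinv_fst, hPinv_snd, Matrix.one_mul, Matrix.one_mul, Matrix.mul_one,
    Matrix.mul_neg]
  simp only [sndPart]
  abel

/-- **Strict equivalence of lifts to `K[ε]` ⟺ the cocycles differ by a coboundary**:
`ρ₂ = P ρ₁ P⁻¹` with `P ≡ 1 mod ε` iff `c₂(g) = c₁(g) + X − ρ̄(g) X ρ̄(g)⁻¹` for some `X ∈ M_n(K)`
(namely `P = 1 + εX`). [cite: Mazur1997Deformation, §21] -/
theorem exists_conj_iff (ρ₁ ρ₂ : DualLift ρbar) :
    (∃ P : GL n (TrivSqZeroExt K K), P.val.map fst = 1 ∧ ∀ g, ρ₂.1 g = P * ρ₁.1 g * P⁻¹) ↔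
      ∃ X : Matrix n n K, ∀ g,
        (ρ₂.cocycle).1 g = (ρ₁.cocycle).1 g + X - (ρbar g).val * X * (ρbar g)⁻¹.val := by
  constructor
  · rintro ⟨P, hP, hconj⟩
    refine ⟨P.val.map snd, fun g => ?_⟩
    rw [cocycle_apply, cocycle_apply, hconj g, map_snd_conj hP ρ₁ g]
    simp only [sndPart]
    rw [Matrix.sub_mul, Matrix.add_mul, Matrix.mul_assoc (P.val.map snd), ← Units.val_mul,
      mul_inv_cancel, Units.val_one, Matrix.mul_one, Matrix.mul_assoc]
  · rintro ⟨X, hX⟩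
    have hP : (dualUnit (1 : GL n K) X).val.map fst = 1 := by
      rw [dualUnit_val_map_fst, Units.val_one]
    refine ⟨dualUnit 1 X, hP, fun g => ?_⟩
    apply Units.ext
    refine matrix_ext_fst_snd ?_ ?_
    · rw [ρ₂.2 g, Units.val_mul, Units.val_mul, matrix_map_fst_mul, matrix_map_fst_mul, hP,
        ρ₁.2 g, Matrix.one_mul]
      have h := congrArg (fun M : Matrix n n (TrivSqZeroExt K K) => M.map fst)
        (dualUnit (1 : GL n K) X).mul_inv
      simp only [matrix_map_fst_mul, hP, Matrix.one_mul, matrix_map_fst_one] at h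
      rw [h, Matrix.mul_one]
    · rw [map_snd_conj hP ρ₁ g, dualUnit_val_map_snd]
      have h2 := hX g
      rw [cocycle_apply, cocycle_apply] at h2
      -- multiply `h2` on the right by `ρ̄(g)`
      have h3 := congrArg (fun M : Matrix n n K => M * (ρbar g).val) h2
      simp only [Matrix.add_mul, Matrix.sub_mul, Matrix.mul_assoc, ← Units.val_mul, inv_mul_cancel,
        Units.val_one, Matrix.mul_one] at h3
      change (ρ₂.1 g).val.map snd = _
      rw [h3]
      simp only [sndPart]

/-- `GL_n(fst) P = 1` iff `fst P = 1` (entrywise). [folklore] -/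
theorem generalLinearGroup_map_fst_eq_one_iff (P : GL n (TrivSqZeroExt K K)) :
    Matrix.GeneralLinearGroup.map (TrivSqZeroExt.fstHom K K K : TrivSqZeroExt K K →+* K) P = 1 ↔
      P.val.map fst = 1 := by
  rw [← Units.val_inj, Units.val_one]
  exact Iff.rfl

/-- **Strict equivalence (Mazur) of lifts to `K[ε]` ⟺ cohomologous cocycles**, in the tree's
vocabulary `Deformation.IsStrictEquiv` for `GL_m`. [cite: Mazur1997Deformation, §21] -/
theorem isStrictEquiv_iff {m : ℕ} {ρbar : Γ →* GL (Fin m) K} (ρ₁ ρ₂ : DualLift ρbar) :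
    IsStrictEquiv (TrivSqZeroExt.fstHom K K K : TrivSqZeroExt K K →+* K) ρ₁.1 ρ₂.1 ↔
      ∃ X : Matrix (Fin m) (Fin m) K, ∀ g,
        (ρ₂.cocycle).1 g = (ρ₁.cocycle).1 g + X - (ρbar g).val * X * (ρbar g)⁻¹.val := by
  rw [← exists_conj_iff]
  simp only [IsStrictEquiv, generalLinearGroup_map_fst_eq_one_iff]

end DualLift

end Literature.NumberTheory.GaloisRepresentations.Deformation
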